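import Literature.RepresentationTheory.TensorFactorIsotypic
import HarnessLib

/-!
# Isotypic polynomials for a product of groups acting place by place: sums of products over the places

Topic `RepresentationTheory`; namespace `Literature.RepresentationTheory`.  Continuation of `TensorFactorIsotypic` (two
factors).  Setting: a field `K`, a "local" variable set `κ`, a finite set of PLACES `o`, and the polynomial ring
`K[X_{κ × o}]` — one copy of the variables `κ` per place.  At each place `v` a family of algebra endomorphisms
`φ v t` of `K[X_κ]` (`t : T`) acts on the variables of that place only (`placeMap v (φ v t)`), with prescribed
eigenvalues `a v t`.

**Theorem** (`mem_span_placeProducts_of_isPlaceIsotypic`).  A polynomial `F ∈ K[X_{κ × o}]` which is a joint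
eigenvector of every `placeMap v (φ v t)` (eigenvalue `a v t`) is a finite `K`-combination of PRODUCTS
`∏_v rename (·, v) (p_v)` whose factors `p_v ∈ K[X_κ]` are joint eigenvectors of the place-`v` family.

This is "the `⊗_v χ_v`-isotypic part of `⊗_v V_v` under `∏_v G_v` is `⊗_v V_v^{χ_v}`" for polynomial rings (Goodman–
Wallach GTM 255 §4.2.1; folklore), proved by induction on the finite type of places (Mathlib
`Fintype.induction_empty_option`) from the two-factor case `TensorFactorIsotypic.mem_span_mul_of_isotypic`.
Use (pub-hodgecm model cell, rows A12/A34, field `dense`): `κ` = the Fock variables of one archimedean place, `o` = the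
real places, `φ v` = the compact group `K_v` acting by substitution; the per-place eigenspaces are identified by
`ClassicalInvariants/VectorCovectorUnitaryInvariants` (`Σ₁₂`), `SegalBargmann/FockRowDeterminantIsotypic` (`ι₁`) and the
scalar-circle lemma (`D₁₂`).  Everything below is proved from Mathlib + the tree; no cited fact.

Provenance: LEAN-IN-TREE rule (2026-08-18), pub-hodgecm model-construction sub-cell, seat mc-binder-2 gen 5; KERNEL only.
[folklore]
-/

noncomputable section

open MvPolynomial
open scoped TensorProduct BigOperators

namespace Literature.RepresentationTheory

universe u

variable {K : Type*} [Field K] {κ : Type*} {T : Type*}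

/-! ## 1. One endomorphism acting at one place -/

section PlaceMap

variable {o : Type*}

/-- The embedding of the variables of place `v`: `i ↦ (i, v)`. [folklore] -/
abbrev atPlace (v : o) : κ → κ × o := fun i => (i, v)

open Classical in
/-- **`ψ` acting at place `v`**: the algebra endomorphism of `K[X_{κ × o}]` which is `ψ` on the variables `(·, v)`
and the identity on the variables of the other places. [folklore] -/
def placeMap (v : o) (ψ : MvPolynomial κ K →ₐ[K] MvPolynomial κ K) :
    MvPolynomial (κ × o) K →ₐ[K] MvPolynomial (κ × o) K :=
  aeval fun p : κ × o => if p.2 = v then rename (atPlace v) (ψ (X p.1)) else X p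

open Classical in
/-- On a variable. [folklore] -/
theorem placeMap_X (v : o) (ψ : MvPolynomial κ K →ₐ[K] MvPolynomial κ K) (p : κ × o) :
    placeMap v ψ (X p) = if p.2 = v then rename (atPlace v) (ψ (X p.1)) else X p := by
  rw [placeMap, aeval_X]

/-- At its own place `placeMap v ψ` is `ψ` (read through `rename (·, v)`). [folklore] -/
theorem placeMap_rename_same (v : o) (ψ : MvPolynomial κ K →ₐ[K] MvPolynomial κ K) (p : MvPolynomial κ K) :
    placeMap v ψ (rename (atPlace v) p) = rename (atPlace v) (ψ p) := by
  have h : (placeMap v ψ).comp (rename (atPlace (κ := κ) v)) = (rename (atPlace v)).comp ψ :=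
    MvPolynomial.algHom_ext fun i => by
      rw [AlgHom.comp_apply, AlgHom.comp_apply, rename_X, placeMap_X, if_pos rfl]
  exact AlgHom.congr_fun h p

/-- At another place it is the identity. [folklore] -/
theorem placeMap_rename_other {v w : o} (h : w ≠ v) (ψ : MvPolynomial κ K →ₐ[K] MvPolynomial κ K)
    (p : MvPolynomial κ K) : placeMap v ψ (rename (atPlace w) p) = rename (atPlace w) p := by
  have h' : (placeMap v ψ).comp (rename (atPlace (κ := κ) w)) = rename (atPlace w) :=
    MvPolynomial.algHom_ext fun i => by
      rw [AlgHom.comp_apply, rename_X, placeMap_X, if_neg h]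
  exact AlgHom.congr_fun h' p

/-- **Place-isotypy**: `F` is a joint eigenvector of every `placeMap v (φ v t)` with eigenvalue `a v t`. [folklore] -/
def IsPlaceIsotypic (φ : o → T → (MvPolynomial κ K →ₐ[K] MvPolynomial κ K)) (a : o → T → K)
    (F : MvPolynomial (κ × o) K) : Prop :=
  ∀ v t, placeMap v (φ v t) F = a v t • F

/-- **The products over the places** of per-place joint eigenvectors. [folklore] -/
def placeProducts [Fintype o] (φ : o → T → (MvPolynomial κ K →ₐ[K] MvPolynomial κ K)) (a : o → T → K) :
    Set (MvPolynomial (κ × o) K) :=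
  {F | ∃ p : o → MvPolynomial κ K, (∀ v, p v ∈ jointEigenspace (fun t => (φ v t).toLinearMap) (a v)) ∧
    F = ∏ v, rename (atPlace v) (p v)}

end PlaceMap

/-! ## 2. Transport along a bijection of the places -/

section Transport

variable {α β : Type*} (e : α ≃ β)

/-- Renaming the places: `K[X_{κ × α}] ≃ K[X_{κ × β}]`. [folklore] -/
abbrev renamePlaces : MvPolynomial (κ × α) K ≃ₐ[K] MvPolynomial (κ × β) K :=
  renameEquiv K (Equiv.prodCongr (Equiv.refl κ) e)

/-- Renaming the places on a one-place polynomial. [folklore] -/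
theorem renamePlaces_rename_atPlace (u : α) (p : MvPolynomial κ K) :
    renamePlaces e (rename (atPlace u) p) = rename (atPlace (e u)) p := by
  rw [renameEquiv_apply, rename_rename]; rfl

/-- `placeMap` commutes with renaming the places. [folklore] -/
theorem renamePlaces_placeMap (u : α) (ψ : MvPolynomial κ K →ₐ[K] MvPolynomial κ K) (F : MvPolynomial (κ × α) K) :
    renamePlaces e (placeMap u ψ F) = placeMap (e u) ψ (renamePlaces e F) := by
  have h : (renamePlaces (K := K) (κ := κ) e).toAlgHom.comp (placeMap u ψ) =
      (placeMap (e u) ψ).comp (renamePlaces e).toAlgHom :=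
    MvPolynomial.algHom_ext fun p => by
      obtain ⟨i, w⟩ := p
      simp only [AlgHom.comp_apply, AlgEquiv.coe_toAlgHom]
      rw [placeMap_X]
      by_cases hw : w = u
      · subst hw
        rw [if_pos rfl, renamePlaces_rename_atPlace, show (X (i, w) : MvPolynomial (κ × α) K) =
          rename (atPlace w) (X i) by rw [rename_X], renamePlaces_rename_atPlace, placeMap_rename_same]
      · rw [if_neg hw, show (X (i, w) : MvPolynomial (κ × α) K) = rename (atPlace w) (X i) by rw [rename_X],
          renamePlaces_rename_atPlace, placeMap_rename_other (fun h => hw (e.injective h))]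
  exact AlgHom.congr_fun h F

end Transport

/-! ## 3. One more place: `K[X_{κ × Option o}] ≃ K[X_{(κ × o) ⊕ κ}]` -/

section OptionStep

variable {o : Type*}

/-- The variables of `κ × Option o` split as those of the places `some _` and those of the place `none`. [folklore] -/
def optionSplit : κ × Option o ≃ (κ × o) ⊕ κ where
  toFun p := match p with
    | (i, some w) => Sum.inl (i, w)
    | (i, none) => Sum.inr i
  invFun s := Sum.elim (fun q => (q.1, some q.2)) (fun i => (i, none)) s
  left_inv p := by rcases p with ⟨i, _ | w⟩ <;> rfl
  right_inv s := by rcases s with ⟨i, w⟩ | i <;> rfl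

/-- The induced algebra equivalence `K[X_{κ × Option o}] ≃ K[X_{(κ × o) ⊕ κ}]`. [folklore] -/
abbrev optionSplitEquiv : MvPolynomial (κ × Option o) K ≃ₐ[K] MvPolynomial ((κ × o) ⊕ κ) K :=
  renameEquiv K optionSplit

/-- The split on a polynomial of the place `some w`. [folklore] -/
theorem optionSplitEquiv_rename_some (w : o) (p : MvPolynomial κ K) :
    optionSplitEquiv (rename (atPlace (some w)) p) = rename Sum.inl (rename (atPlace w) p) := by
  rw [renameEquiv_apply, rename_rename, rename_rename]; rfl

/-- The split on a polynomial of the place `none`. [folklore] -/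
theorem optionSplitEquiv_rename_none (p : MvPolynomial κ K) :
    optionSplitEquiv (o := o) (rename (atPlace none) p) = rename Sum.inr p := by
  rw [renameEquiv_apply, rename_rename]; rfl

/-- The place `some w` becomes the place `w` of the first factor. [folklore] -/
theorem optionSplitEquiv_placeMap_some (w : o) (ψ : MvPolynomial κ K →ₐ[K] MvPolynomial κ K)
    (F : MvPolynomial (κ × Option o) K) :
    optionSplitEquiv (placeMap (some w) ψ F) = sumMap (placeMap w ψ) (AlgHom.id K _) (optionSplitEquiv F) := by
  have h : (optionSplitEquiv (K := K) (κ := κ) (o := o)).toAlgHom.comp (placeMap (some w) ψ) =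
      (sumMap (placeMap w ψ) (AlgHom.id K _)).comp optionSplitEquiv.toAlgHom :=
    MvPolynomial.algHom_ext fun p => by
      obtain ⟨i, _ | w'⟩ := p
      · -- the `none` variable
        simp only [AlgHom.comp_apply, AlgEquiv.coe_toAlgHom]
        rw [placeMap_X, if_neg (Option.some_ne_none w).symm,
          show (X (i, none) : MvPolynomial (κ × Option o) K) = rename (atPlace none) (X i) by rw [rename_X],
          optionSplitEquiv_rename_none, sumMap_rename_inr, AlgHom.id_apply]
      · simp only [AlgHom.comp_apply, AlgEquiv.coe_toAlgHom]
        rw [show (X (i, some w') : MvPolynomial (κ × Option o) K) = rename (atPlace (some w')) (X i) by rw [rename_X]]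
        by_cases hw : w' = w
        · subst hw
          rw [placeMap_rename_same, optionSplitEquiv_rename_some, optionSplitEquiv_rename_some, sumMap_rename_inl,
            placeMap_rename_same]
        · rw [placeMap_rename_other (fun h => hw (Option.some_injective _ h)), optionSplitEquiv_rename_some,
            sumMap_rename_inl, placeMap_rename_other hw]
  exact AlgHom.congr_fun h F

/-- The place `none` becomes the second factor. [folklore] -/
theorem optionSplitEquiv_placeMap_none (ψ : MvPolynomial κ K →ₐ[K] MvPolynomial κ K)
    (F : MvPolynomial (κ × Option o) K) :
    optionSplitEquiv (placeMap none ψ F) = sumMap (AlgHom.id K (MvPolynomial (κ × o) K)) ψ (optionSplitEquiv F) := by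
  have h : (optionSplitEquiv (K := K) (κ := κ) (o := o)).toAlgHom.comp (placeMap none ψ) =
      (sumMap (AlgHom.id K _) ψ).comp optionSplitEquiv.toAlgHom :=
    MvPolynomial.algHom_ext fun p => by
      obtain ⟨i, _ | w'⟩ := p
      · simp only [AlgHom.comp_apply, AlgEquiv.coe_toAlgHom]
        rw [show (X (i, none) : MvPolynomial (κ × Option o) K) = rename (atPlace none) (X i) by rw [rename_X],
          placeMap_rename_same, optionSplitEquiv_rename_none, optionSplitEquiv_rename_none, sumMap_rename_inr]
      · simp only [AlgHom.comp_apply, AlgEquiv.coe_toAlgHom]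
        rw [show (X (i, some w') : MvPolynomial (κ × Option o) K) = rename (atPlace (some w')) (X i) by rw [rename_X],
          placeMap_rename_other (Option.some_ne_none w'), optionSplitEquiv_rename_some, sumMap_rename_inl,
          AlgHom.id_apply]
  exact AlgHom.congr_fun h F

end OptionStep

/-! ## 4. The theorem -/

section Main

/-- The statement, for a type of places `o` (induction motive). [folklore] -/
private def Claim (K : Type*) [Field K] (κ T : Type*) (o : Type u) [Fintype o] : Prop :=
  ∀ (φ : o → T → (MvPolynomial κ K →ₐ[K] MvPolynomial κ K)) (a : o → T → K)
    (F : MvPolynomial (κ × o) K), IsPlaceIsotypic φ a F → F ∈ Submodule.span K (placeProducts φ a)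

/-- The motive is invariant under bijections of the places. [folklore] -/
private theorem claim_of_equiv {α β : Type u} [Fintype β] (e : α ≃ β)
    (h : @Claim K _ κ T α (Fintype.ofEquiv β e.symm)) : Claim K κ T β := by
  intro φ a F hF
  letI : Fintype α := Fintype.ofEquiv β e.symm
  -- pull `F` back to the places `α`
  set F' : MvPolynomial (κ × α) K := renamePlaces e.symm F with hF'
  have hback : renamePlaces e F' = F := by
    rw [hF', renameEquiv_apply, renameEquiv_apply, rename_rename]
    convert rename_id_apply F using 2
    (ext ⟨i, w⟩; simp)
  have hF'iso : IsPlaceIsotypic (fun u => φ (e u)) (fun u => a (e u)) F' := by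
    intro u t
    apply (renamePlaces (K := K) (κ := κ) e).injective
    rw [renamePlaces_placeMap, map_smul, hback]
    exact hF (e u) t
  have hmem := h (fun u => φ (e u)) (fun u => a (e u)) F' hF'iso
  -- push the span forward along `renamePlaces e`
  rw [← hback]
  have himg : (renamePlaces (K := K) (κ := κ) e).toLinearMap '' placeProducts (fun u => φ (e u)) (fun u => a (e u)) ⊆
      placeProducts φ a := by
    rintro _ ⟨_, ⟨p, hp, rfl⟩, rfl⟩
    refine ⟨fun v => p (e.symm v), fun v => by simpa only [Equiv.apply_symm_apply] using hp (e.symm v), ?_⟩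
    rw [AlgEquiv.toLinearMap_apply, map_prod]
    refine Fintype.prod_equiv e _ _ fun u => ?_
    rw [renamePlaces_rename_atPlace]
    simp only [Equiv.symm_apply_apply]
  have := Submodule.mem_map_of_mem (f := (renamePlaces (K := K) (κ := κ) e).toLinearMap) hmem
  rw [Submodule.map_span] at this
  exact Submodule.span_mono himg this

/-- No places: constants. [folklore] -/
private theorem claim_empty : Claim K κ T PEmpty := by
  intro φ a F _
  have hF : F = C (F.coeff 0) := eq_C_of_isEmpty F
  rw [hF, ← mul_one (C (F.coeff 0)), ← smul_eq_C_mul]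
  refine Submodule.smul_mem _ _ (Submodule.subset_span ⟨fun v => PEmpty.elim v, fun v => PEmpty.elim v, ?_⟩)
  rw [Fintype.prod_empty]

/-- One more place: the two-factor step `TensorFactorIsotypic.mem_span_mul_of_isotypic`. [folklore] -/
private theorem claim_option {o : Type u} [Fintype o] (h : Claim K κ T o) : Claim K κ T (Option o) := by
  intro φ a F hF
  -- two-factor form of the hypotheses on `optionSplitEquiv F`
  set G := optionSplitEquiv (K := K) (κ := κ) (o := o) F with hG
  have hA : ∀ vt : o × T, sumMap (placeMap vt.1 (φ (some vt.1) vt.2)) (AlgHom.id K _) G = a (some vt.1) vt.2 • G := by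
    rintro ⟨w, t⟩
    rw [hG, ← optionSplitEquiv_placeMap_some, hF (some w) t, map_smul]
  have hB : ∀ t : T, sumMap (AlgHom.id K _) (φ none t) G = a none t • G := by
    intro t
    rw [hG, ← optionSplitEquiv_placeMap_none, hF none t, map_smul]
  have hG' := mem_span_mul_of_isotypic (fun vt : o × T => placeMap vt.1 (φ (some vt.1) vt.2))
    (fun vt => a (some vt.1) vt.2) (fun t => φ none t) (fun t => a none t) hA hB
  -- the first-factor joint eigenvectors are place-isotypic on `o`: induction hypothesis
  have hIH : ∀ P : MvPolynomial (κ × o) K,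
      P ∈ jointEigenspace (fun vt : o × T => (placeMap vt.1 (φ (some vt.1) vt.2)).toLinearMap)
        (fun vt => a (some vt.1) vt.2) →
      P ∈ Submodule.span K (placeProducts (fun w => φ (some w)) (fun w => a (some w))) := fun P hP =>
    h (fun w => φ (some w)) (fun w => a (some w)) P fun w t => mem_jointEigenspace.mp hP (w, t)
  -- pull back along `optionSplitEquiv`
  have hFG : F = optionSplitEquiv.symm G := by rw [hG, AlgEquiv.symm_apply_apply]
  rw [hFG]
  have hspan : Submodule.span K {P | ∃ p ∈ jointEigenspace
        (fun vt : o × T => (placeMap vt.1 (φ (some vt.1) vt.2)).toLinearMap) (fun vt => a (some vt.1) vt.2),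
        ∃ q ∈ jointEigenspace (fun t => (φ none t).toLinearMap) (fun t => a none t),
        P = rename Sum.inl p * rename Sum.inr q} ≤
      (Submodule.span K (placeProducts φ a)).comap
        (optionSplitEquiv (K := K) (κ := κ) (o := o)).symm.toLinearMap := by
    rw [Submodule.span_le]
    rintro _ ⟨p, hp, q, hq, rfl⟩
    rw [SetLike.mem_coe, Submodule.mem_comap, AlgEquiv.toLinearMap_apply, map_mul]
    -- `p` is a combination of place products over `o`; distribute
    have hp' := hIH p hp
    have hmul : ∀ P ∈ Submodule.span K (placeProducts (fun w => φ (some w)) (fun w => a (some w))),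
        optionSplitEquiv.symm (rename Sum.inl P) * optionSplitEquiv.symm (rename Sum.inr q) ∈
          Submodule.span K (placeProducts φ a) := by
      intro P hP
      induction hP using Submodule.span_induction with
      | mem P' hP' =>
        obtain ⟨pf, hpf, rfl⟩ := hP'
        refine Submodule.subset_span ⟨fun v => Option.elim v q pf, fun v => ?_, ?_⟩
        · cases v with
          | none => exact hq
          | some w => exact hpf w
        · have h1 : (optionSplitEquiv (K := K) (κ := κ) (o := o)).symm (rename Sum.inr q) =
              rename (atPlace none) q := by
            apply (optionSplitEquiv (K := K) (κ := κ) (o := o)).injective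
            rw [AlgEquiv.apply_symm_apply, optionSplitEquiv_rename_none]
          have h2 : ∀ w, (optionSplitEquiv (K := K) (κ := κ) (o := o)).symm
              (rename Sum.inl (rename (atPlace w) (pf w))) = rename (atPlace (some w)) (pf w) := fun w => by
            apply (optionSplitEquiv (K := K) (κ := κ) (o := o)).injective
            rw [AlgEquiv.apply_symm_apply, optionSplitEquiv_rename_some]
          simp only [Fintype.prod_option, Option.elim_none, Option.elim_some, map_prod, h1, h2]
          rw [mul_comm]
      | zero => rw [map_zero, map_zero, zero_mul]; exact Submodule.zero_mem _
      | add P₁ P₂ _ _ h₁ h₂ => rw [map_add, map_add, add_mul]; exact Submodule.add_mem _ h₁ h₂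
      | smul c P _ hP => rw [map_smul, map_smul, smul_mul_assoc]; exact Submodule.smul_mem _ _ hP
    exact hmul p hp'
  exact hspan hG'

/-- **Place-isotypic polynomials are sums of products of per-place joint eigenvectors.** [folklore] -/
theorem mem_span_placeProducts_of_isPlaceIsotypic {o : Type u} [Fintype o]
    (φ : o → T → (MvPolynomial κ K →ₐ[K] MvPolynomial κ K)) (a : o → T → K) {F : MvPolynomial (κ × o) K}
    (hF : IsPlaceIsotypic φ a F) : F ∈ Submodule.span K (placeProducts φ a) :=
  (Fintype.induction_empty_option (P := fun α _ => Claim K κ T α)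
    (fun _ _ _ e h => claim_of_equiv e h) claim_empty (fun _ _ h => claim_option h) o) φ a F hF

open Classical in
/-- Conversely every place product is place-isotypic, with the product eigenvalues read place by place.
[folklore] -/
theorem isPlaceIsotypic_prod {o : Type u} [Fintype o]
    (φ : o → T → (MvPolynomial κ K →ₐ[K] MvPolynomial κ K)) (a : o → T → K) (p : o → MvPolynomial κ K)
    (hp : ∀ v, p v ∈ jointEigenspace (fun t => (φ v t).toLinearMap) (a v)) :
    IsPlaceIsotypic φ a (∏ v, rename (atPlace v) (p v)) := by
  intro v t
  rw [map_prod]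
  have key : ∀ w, placeMap v (φ v t) (rename (atPlace w) (p w)) =
      (if w = v then a v t else 1) • rename (atPlace w) (p w) := by
    intro w
    by_cases hw : w = v
    · subst hw
      rw [if_pos rfl, placeMap_rename_same, show φ w t (p w) = a w t • p w from mem_jointEigenspace.mp (hp w) t,
        map_smul]
    · rw [if_neg hw, one_smul, placeMap_rename_other hw]
  simp_rw [key]
  rw [← Finset.prod_erase_mul _ _ (Finset.mem_univ v), if_pos rfl,
    ← Finset.prod_erase_mul Finset.univ (fun w => rename (atPlace w) (p w)) (Finset.mem_univ v),
    Finset.prod_congr rfl (fun w hw => by rw [if_neg (Finset.ne_of_mem_erase hw), one_smul]), mul_smul_comm]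

end Main

end Literature.RepresentationTheory

end
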